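import Summits.CriticalPhenomena.Ising3DConformalLimit.Theorems.HyperoctahedralRPLimitRotationInvariantQuarterTurnDefs
import Summits.CriticalPhenomena.Ising3DConformalLimit.Theorems.HyperoctahedralRPTwoPointKernelOfLimit
import Summits.CriticalPhenomena.Ising3DConformalLimit.Theorems.MoebiusLimitExists.Negative.MeshContinuity
import Summits.CriticalPhenomena.Ising3DConformalLimit.Theorems.HyperoctahedralRPInversionUpgradeNormalisedOSLayer
import Summits.CriticalPhenomena.Ising3DConformalLimit.Theorems.HyperoctahedralRPInversionUpgradeNormalisedGaussianDomination
import HarnessLib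

/-!
# Regularity of a normalised scaling limit of the critical `ℤ³` Ising correlators: stub
# `stub_limitRegularity` (S1a) of line `quarter-turn-liouville` for crux
# `HyperoctahedralRP.LimitRotationInvariant` (stmt-CriticalPhenomena-1980)

Statement.  Every candidate limit `(ρ, Δ, S)` satisfying the crux hypotheses `CruxHyp ρ Δ S` (`ρ > 0` on
`(0,1]`, `S` the pointwise scaling limit of `criticalCorr 3` under `ρ`, `S = 0` off `NonCoincident`,
non-degenerate two-point function, translation invariance, scale covariance with exponent `Δ`) has the
model-independent structure `LimitRegularity Δ S` consumed by the analytic stubs of the line: the window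
`1/2 ≤ Δ ≤ 1`, translation invariance, scale covariance, normalisation, non-degeneracy, hyperoctahedral
invariance, permutation symmetry (E3), the Gaussian-domination a priori bound `PairDominated Δ S`, and
continuity off the diagonals.

Proof.  Every conjunct has a landed precedent.
* Window: first clause of `HyperoctahedralRPTwoPoint.twoPointKernelOfLimit_proof` (infrared bound and
  Simon–Lieb, `scalingDimension_mem_Icc_holds`).
* Hyperoctahedral invariance (`isHyperoctahedralInvariant_of_limit`): the signed coordinate permutation
  `signedPerm σ ε` is the linear isometry `piLpCongrRight (±1) ∘ piLpCongrLeft σ⁻¹`, so on `NonCoincident`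
  this is `HyperoctahedralRPTwoPoint.limit_signedPerm` (free sign flips and coordinate permutations of any
  limit, `MoebiusLimitExistsNegative.limit_signFlip` / `limit_coordPerm`); off `NonCoincident` both sides
  vanish by the normalisation (an isometry preserves non-injectivity).
* Permutation symmetry: `FreeEndpointGaussianClosure.isPermutationSymmetric_of_limit`.
* `PairDominated` (`pairDominated_of_limit`): the kernel `u ↦ S 2 ![0, u]` is continuous on the compact
  unit sphere, hence bounded there by some `K₀`; with translation invariance and homogeneity of degree
  `-2Δ ≤ 0` this gives the two-point bound `S 2 ![p, q] ≤ K r^{-2Δ}` whenever `0 < r ≤ ‖p - q‖`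
  (`two_point_le_of_limit`, `K = max K₀ 1`).  For general `n`: off `NonCoincident` and for odd `n` the
  correlation vanishes (`InversionUpgradeNormalisedNegative.limit_odd_eq_zero`); for `n = 2m` and `x`
  injective, `0 < S_{2m}(x)` (`InversionDefectInvolution.stub_evenPos`) and
  `S_{2m}(x) ≤ 𝒢_m[S₂](x)` (`FreeEndpointGaussianClosure.stub_gaussianDomination`), and a pairing
  functional whose entries at DISTINCT indices lie in `[0, B]`, `B = K r^{-2Δ}`, is at most `(2m)! Bᵐ`
  (`pairingSum_le_of_forall_ne`, the index-restricted form of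
  `MoebiusLimitExistsOnlyInteraction.pairingSum_le_factorial_mul_pow`); finally
  `(2m)! Kᵐ r^{-2mΔ} ≤ K^{2m+1} (2m)! r^{-2mΔ}` as `K ≥ 1`.
* Continuity off the diagonals: `LimitMeshContinuity.continuousOn_limit`.

References: C. M. Newman, Z. Wahrsch. verw. Gebiete 33 (1975) 75–93 (Gaussian inequality);
S. Friedli, Y. Velenik, *Statistical Mechanics of Lattice Systems* (CUP 2017), Ex. 3.14 (lattice
symmetries); K. Osterwalder, R. Schrader, Comm. Math. Phys. 31 (1973), (E3).
No definitions are introduced: the line's vocabulary (`CruxHyp`, `signedPerm`, `IsHyperoctahedralInvariant`,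
`PairDominated`, `LimitRegularity`) is imported from `…Theorems.HyperoctahedralRPLimitRotationInvariantQuarterTurnDefs`.
-/

noncomputable section

open scoped BigOperators
open Literature.Probability.LatticeModels
open Literature.MathematicalPhysics.QuantumFieldTheory

namespace Summit.CriticalPhenomena.Ising3DConformalLimit.Cruxes.LimitRotationInvariant.QuarterTurnLiouville

/-! ### Hyperoctahedral invariance of a normalised limit -/

/-- **Every normalised pointwise scaling limit of `criticalCorr 3` is hyperoctahedrally invariant.**  The
signed coordinate permutation `signedPerm σ ε` is the linear isometry
`piLpCongrRight (±1) ∘ piLpCongrLeft σ⁻¹`; on `NonCoincident` the invariance is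
`HyperoctahedralRPTwoPoint.limit_signedPerm` (sign flips and coordinate permutations are free for any
limit), off `NonCoincident` both sides vanish by the normalisation. [folklore] -/
theorem isHyperoctahedralInvariant_of_limit {ρ : ℝ → ℝ} {S : CorrFamily 3}
    (hlim : HasPointwiseScalingLimit (criticalCorr 3) ρ S)
    (hnorm : ∀ n z, z ∉ NonCoincident 3 n → S n z = 0) : IsHyperoctahedralInvariant S := by
  intro n σ ε x
  -- the signed permutation as a linear isometry of `ℝ³`
  obtain ⟨R, hR⟩ : ∃ R : EuclideanSpace ℝ (Fin 3) ≃ₗᵢ[ℝ] EuclideanSpace ℝ (Fin 3),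
      ∀ (p : EuclideanSpace ℝ (Fin 3)) (j : Fin 3),
        R p j = (if ε j then (1:ℝ) else -1) * p (σ j) :=
    ⟨(LinearIsometryEquiv.piLpCongrLeft 2 ℝ ℝ σ.symm).trans
        (LinearIsometryEquiv.piLpCongrRight 2 fun j =>
          if ε j then LinearIsometryEquiv.refl ℝ ℝ else LinearIsometryEquiv.neg ℝ),
      fun p j => by
        simp only [LinearIsometryEquiv.trans_apply, LinearIsometryEquiv.piLpCongrRight_apply,
          PiLp.toLp_apply, MoebiusLimitExistsNegative.coordPerm_apply, Equiv.symm_symm]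
        split_ifs <;> simp⟩
  have hcfg : (fun i => signedPerm σ ε (x i)) = fun i => R (x i) := by
    funext i
    ext j
    rw [hR]
    rfl
  rw [hcfg]
  by_cases hx : x ∈ NonCoincident 3 n
  · exact HyperoctahedralRPTwoPoint.limit_signedPerm hlim σ.symm (fun j => if ε j then 1 else -1) R
      (fun p j => by
        rw [hR, Equiv.symm_symm]
        split_ifs <;> simp) hx
  · rw [hnorm n _ (mt (MoebiusLimitExistsNegative.map_mem_nonCoincident_iff R x).1 hx), hnorm n x hx]

/-! ### The two-point bound and Gaussian domination -/

/-- **Two-point bound.**  For a non-degenerate, translation-invariant, scale-covariant pointwise scaling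
limit of `criticalCorr 3` there is `K ≥ 1` with `S 2 ![p, q] ≤ K · r^{-2Δ}` whenever `0 < r ≤ ‖p - q‖`:
the kernel `u ↦ S 2 ![0, u]` is continuous on the compact unit sphere (hence bounded by some `K₀`),
`S 2 ![p, q] = S 2 ![0, q - p] = ‖q - p‖^{-2Δ} S 2 ![0, u]` with `u` the unit vector of `q - p`
(translation invariance, homogeneity), and `‖q - p‖^{-2Δ} ≤ r^{-2Δ}` as `Δ ≥ 1/2 ≥ 0`
(`HyperoctahedralRPTwoPoint.twoPointKernelOfLimit_proof`). [folklore] -/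
theorem two_point_le_of_limit {ρ : ℝ → ℝ} {Δ : ℝ} {S : CorrFamily 3}
    (hρ : ∀ δ ∈ Set.Ioc (0:ℝ) 1, 0 < ρ δ) (hlim : HasPointwiseScalingLimit (criticalCorr 3) ρ S)
    (hnd : IsNondegenerateTwoPoint S) (htr : IsTranslationInvariant S) (hsc : IsScaleCovariant Δ S) :
    ∃ K : ℝ, 1 ≤ K ∧ ∀ (p q : EuclideanSpace ℝ (Fin 3)) (r : ℝ), 0 < r → p ≠ q → r ≤ ‖p - q‖ →
      S 2 ![p, q] ≤ K * r ^ (-(2 * Δ)) := by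
  obtain ⟨hwin, hcont, hpos, hhom, -⟩ :=
    HyperoctahedralRPTwoPoint.twoPointKernelOfLimit_proof ρ Δ S hρ hlim hnd htr hsc
  -- a bound of the kernel on the unit sphere
  have hsph : Metric.sphere (0 : EuclideanSpace ℝ (Fin 3)) 1 ⊆ {0}ᶜ := by
    intro u hu h0
    rw [Set.mem_singleton_iff] at h0
    rw [h0, Metric.mem_sphere, dist_self] at hu
    exact zero_ne_one hu
  obtain ⟨K₀, hK₀⟩ :=
    (isCompact_sphere (0 : EuclideanSpace ℝ (Fin 3)) 1).exists_bound_of_continuousOn (hcont.mono hsph)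
  refine ⟨max K₀ 1, le_max_right _ _, fun p q r hr hpq hrpq => ?_⟩
  have hd : 0 < ‖q - p‖ := norm_pos_iff.2 (sub_ne_zero.2 (Ne.symm hpq))
  set u : EuclideanSpace ℝ (Fin 3) := ‖q - p‖⁻¹ • (q - p) with hu
  have hu1 : u ∈ Metric.sphere (0 : EuclideanSpace ℝ (Fin 3)) 1 := by
    rw [mem_sphere_zero_iff_norm, hu, norm_smul, norm_inv, norm_norm, inv_mul_cancel₀ hd.ne']
  have hu0 : u ≠ 0 := fun h0 => hsph hu1 h0
  have hqp : q - p = ‖q - p‖ • u := by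
    rw [hu, smul_smul, mul_inv_cancel₀ hd.ne', one_smul]
  -- translate `p` to the origin, then scale
  have h1 : S 2 ![p, q] = S 2 ![0, q - p] := by
    have h := htr 2 (-p) ![p, q]
    rw [← h]
    congr 1
    funext i
    fin_cases i <;> simp [sub_eq_add_neg]
  have h2 : S 2 ![0, q - p] = ‖q - p‖ ^ (-(2 * Δ)) * S 2 ![0, u] := by
    have h := hhom _ hd u
    rwa [← hqp] at h
  have hK : S 2 ![0, u] ≤ max K₀ 1 := by
    have h := hK₀ u hu1
    rw [Real.norm_eq_abs] at h
    exact ((le_abs_self _).trans h).trans (le_max_left _ _)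
  have hrpow : ‖q - p‖ ^ (-(2 * Δ)) ≤ r ^ (-(2 * Δ)) :=
    Real.rpow_le_rpow_of_nonpos hr (by rwa [norm_sub_rev] at hrpq) (by linarith [hwin.1])
  rw [h1, h2]
  calc ‖q - p‖ ^ (-(2 * Δ)) * S 2 ![0, u] ≤ r ^ (-(2 * Δ)) * max K₀ 1 :=
        mul_le_mul hrpow hK (hpos u hu0).le (Real.rpow_nonneg hr.le _)
    _ = max K₀ 1 * r ^ (-(2 * Δ)) := mul_comm _ _

/-- A pairing functional whose entries at DISTINCT indices lie in `[0, B]` is at most `(2m)! · Bᵐ`: each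
of the `(2m)!` orderings contributes a product of `m` entries at distinct indices, and `(2ᵐ m!)⁻¹ ≤ 1`
(the index-restricted form of `MoebiusLimitExistsOnlyInteraction.pairingSum_le_factorial_mul_pow`).
[folklore] -/
theorem pairingSum_le_of_forall_ne {α : Type*} (S₂ : α → α → ℝ) {B : ℝ} (m : ℕ)
    (x : Fin (2 * m) → α) (h0 : ∀ i j, i ≠ j → 0 ≤ S₂ (x i) (x j))
    (hle : ∀ i j, i ≠ j → S₂ (x i) (x j) ≤ B) :
    pairingSum S₂ m x ≤ (2 * m).factorial * B ^ m := by
  -- adapted from Theorems/EnergyNotSigmaSquaredMoebiusLimitExistsLocallyBounded.lean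
  -- `pairingSum_le_factorial_mul_pow`
  unfold pairingSum
  have hne : ∀ (τ : Equiv.Perm (Fin (2 * m))) (j : Fin m),
      τ (pairIdx m (j, 0)) ≠ τ (pairIdx m (j, 1)) := fun τ j hj => by
    have := (pairIdx m).injective (τ.injective hj)
    simp at this
  have hsum0 : 0 ≤ ∑ τ : Equiv.Perm (Fin (2 * m)),
      ∏ j : Fin m, S₂ (x (τ (pairIdx m (j, 0)))) (x (τ (pairIdx m (j, 1)))) :=
    Finset.sum_nonneg fun τ _ => Finset.prod_nonneg fun j _ => h0 _ _ (hne τ j)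
  have hsum : ∑ τ : Equiv.Perm (Fin (2 * m)),
      ∏ j : Fin m, S₂ (x (τ (pairIdx m (j, 0)))) (x (τ (pairIdx m (j, 1)))) ≤
        (2 * m).factorial * B ^ m := by
    calc ∑ τ : Equiv.Perm (Fin (2 * m)),
          ∏ j : Fin m, S₂ (x (τ (pairIdx m (j, 0)))) (x (τ (pairIdx m (j, 1))))
        ≤ ∑ _τ : Equiv.Perm (Fin (2 * m)), B ^ m := by
          refine Finset.sum_le_sum fun τ _ => ?_
          calc ∏ j : Fin m, S₂ (x (τ (pairIdx m (j, 0)))) (x (τ (pairIdx m (j, 1))))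
              ≤ ∏ _j : Fin m, B :=
                Finset.prod_le_prod (fun j _ => h0 _ _ (hne τ j)) fun j _ => hle _ _ (hne τ j)
            _ = B ^ m := by rw [Finset.prod_const, Finset.card_univ, Fintype.card_fin]
      _ = (2 * m).factorial * B ^ m := by
          rw [Finset.sum_const, Finset.card_univ, Fintype.card_perm, Fintype.card_fin, nsmul_eq_mul]
  have hc : ((2 : ℝ) ^ m * m.factorial)⁻¹ ≤ 1 := by
    apply inv_le_one_of_one_le₀
    have h1 : (1 : ℝ) ≤ 2 ^ m := one_le_pow₀ (by norm_num)
    have h2 : (1 : ℝ) ≤ m.factorial := by exact_mod_cast m.factorial_pos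
    nlinarith
  calc ((2 : ℝ) ^ m * m.factorial)⁻¹ * ∑ τ : Equiv.Perm (Fin (2 * m)),
        ∏ j : Fin m, S₂ (x (τ (pairIdx m (j, 0)))) (x (τ (pairIdx m (j, 1))))
      ≤ 1 * ∑ τ : Equiv.Perm (Fin (2 * m)),
        ∏ j : Fin m, S₂ (x (τ (pairIdx m (j, 0)))) (x (τ (pairIdx m (j, 1)))) :=
        mul_le_mul_of_nonneg_right hc hsum0
    _ ≤ (2 * m).factorial * B ^ m := by rw [one_mul]; exact hsum

/-- **Gaussian domination a priori bound `PairDominated Δ S`** for a normalised, non-degenerate,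
translation-invariant, scale-covariant pointwise scaling limit of `criticalCorr 3`, with the constant
`C = K` of `two_point_le_of_limit`: off `NonCoincident` and at odd orders the correlation vanishes
(`InversionUpgradeNormalisedNegative.limit_odd_eq_zero`); at even order `2m` on `NonCoincident`,
`0 < S_{2m}(x) ≤ 𝒢_m[S₂](x) ≤ (2m)! (K r^{-2Δ})ᵐ ≤ K^{2m+1} (2m)! r^{-2mΔ}`
(`InversionDefectInvolution.stub_evenPos`, `FreeEndpointGaussianClosure.stub_gaussianDomination`,
`pairingSum_le_of_forall_ne`, `K ≥ 1`). [folklore] -/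
theorem pairDominated_of_limit {ρ : ℝ → ℝ} {Δ : ℝ} {S : CorrFamily 3}
    (hρ : ∀ δ ∈ Set.Ioc (0:ℝ) 1, 0 < ρ δ) (hlim : HasPointwiseScalingLimit (criticalCorr 3) ρ S)
    (hnorm : ∀ n z, z ∉ NonCoincident 3 n → S n z = 0) (hnd : IsNondegenerateTwoPoint S)
    (htr : IsTranslationInvariant S) (hsc : IsScaleCovariant Δ S) : PairDominated Δ S := by
  obtain ⟨K, hK1, hK⟩ := two_point_le_of_limit hρ hlim hnd htr hsc
  have hK0 : 0 ≤ K := zero_le_one.trans hK1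
  refine ⟨K, fun n x r hr hsep => ?_⟩
  have hrhs0 : 0 ≤ K ^ (n + 1) * (Nat.factorial n : ℝ) * r ^ (-(n : ℝ) * Δ) :=
    mul_nonneg (mul_nonneg (pow_nonneg hK0 _) (Nat.cast_nonneg _)) (Real.rpow_nonneg hr.le _)
  by_cases hx : x ∈ NonCoincident 3 n
  swap
  · rw [hnorm n x hx, abs_zero]
    exact hrhs0
  rcases Nat.even_or_odd n with ⟨m, hm⟩ | hodd
  swap
  · rw [InversionUpgradeNormalisedNegative.limit_odd_eq_zero hlim hnorm hodd x, abs_zero]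
    exact hrhs0
  obtain rfl : n = 2 * m := by omega
  have hinj : Function.Injective x := hx
  have hSpos : 0 < S (2 * m) x :=
    InversionUpgradeNormalised.InversionDefectInvolution.stub_evenPos ρ S hρ hlim hnd _
      (even_two_mul m) x hx
  have hGD : S (2 * m) x ≤ pairingSum (fun a b => S 2 ![a, b]) m x :=
    InversionUpgradeNormalised.FreeEndpointGaussianClosure.stub_gaussianDomination ρ S hρ hlim m x hx
  have hpair : pairingSum (fun a b => S 2 ![a, b]) m x ≤
      (2 * m).factorial * (K * r ^ (-(2 * Δ))) ^ m :=
    pairingSum_le_of_forall_ne (fun a b => S 2 ![a, b]) m x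
      (fun i j hij => (hnd _ (pair_mem_nonCoincident (hinj.ne hij))).le)
      (fun i j hij => hK (x i) (x j) r hr (hinj.ne hij) (hsep i j hij))
  have hKm : K ^ m ≤ K ^ (2 * m + 1) := pow_le_pow_right₀ hK1 (by omega)
  have hr0 : 0 ≤ r ^ (-((2 * m : ℕ) : ℝ) * Δ) := Real.rpow_nonneg hr.le _
  rw [abs_of_pos hSpos]
  calc S (2 * m) x ≤ pairingSum (fun a b => S 2 ![a, b]) m x := hGD
    _ ≤ (2 * m).factorial * (K * r ^ (-(2 * Δ))) ^ m := hpair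
    _ = (Nat.factorial (2 * m) : ℝ) * K ^ m * r ^ (-((2 * m : ℕ) : ℝ) * Δ) := by
        have hexp : -(2 * Δ) * (m : ℝ) = -((2 * m : ℕ) : ℝ) * Δ := by push_cast; ring
        rw [mul_pow, ← Real.rpow_mul_natCast hr.le, hexp]
        ring
    _ ≤ K ^ (2 * m + 1) * (Nat.factorial (2 * m) : ℝ) * r ^ (-((2 * m : ℕ) : ℝ) * Δ) := by
        refine mul_le_mul_of_nonneg_right ?_ hr0
        rw [mul_comm]
        exact mul_le_mul_of_nonneg_right hKm (Nat.cast_nonneg _)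

/-! ### The registered stub -/

/-- **S1a · `stub_limitRegularity`.**  Everything model-independent the line consumes about a limit `S`
as in the crux, minus reflection positivity: the window `1/2 ≤ Δ ≤ 1`
(`HyperoctahedralRPTwoPoint.twoPointKernelOfLimit_proof`, first conjunct), translation invariance / scale
covariance / normalisation / non-degeneracy (hypotheses), hyperoctahedral invariance
(`isHyperoctahedralInvariant_of_limit`), permutation symmetry
(`FreeEndpointGaussianClosure.isPermutationSymmetric_of_limit`), Gaussian domination `PairDominated`
(`pairDominated_of_limit`), continuity off the diagonals (`LimitMeshContinuity.continuousOn_limit`).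
[folklore] -/
theorem stub_limitRegularity :
    ∀ (ρ : ℝ → ℝ) (Δ : ℝ) (S : CorrFamily 3), CruxHyp ρ Δ S → LimitRegularity Δ S := by
  intro ρ Δ S hH
  obtain ⟨hρ, hlim, hnorm, hnd, htr, hsc⟩ := hH
  exact ⟨(HyperoctahedralRPTwoPoint.twoPointKernelOfLimit_proof ρ Δ S hρ hlim hnd htr hsc).1, htr, hsc,
    hnorm, hnd, isHyperoctahedralInvariant_of_limit hlim hnorm,
    InversionUpgradeNormalised.FreeEndpointGaussianClosure.isPermutationSymmetric_of_limit hlim hnorm,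
    pairDominated_of_limit hρ hlim hnorm hnd htr hsc,
    fun n => LimitMeshContinuity.continuousOn_limit hlim n⟩

end Summit.CriticalPhenomena.Ising3DConformalLimit.Cruxes.LimitRotationInvariant.QuarterTurnLiouville

end
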